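import Literature.Computability.AlgebraicComplexity.BCMV25PermanentalVarieties
import HarnessLib

/-!
# Guterman–Meshulam–Spiridonov 2023: a linear space of `n × n` matrices over ANY field in which every
# matrix has PERMANENTAL rank `≤ k` has dimension `≤ k·n` — NAMED FACT

Topic `Literature/LinearAlgebra` (sibling of `Literature.LinearAlgebra.Meshulam1985_exists_rank_gt`, the rank version
(Flanders 1962 / Meshulam 1985), of which this is the printed "permanental counterpart").  Consumer: stub S2
`stub_gms : GMSBound` of the crux lines `Cruxes/DualUnipotentThreeHalves/Lines/{slow_planes,flag_cost,radical_split}.lean`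
(val-idea-9; item `stmt-ValiantsHypothesis-24318`, `GrenetZeon.DualUnipotentThreeHalves`); typed on the val-lit desk's
order (desk g12 RULINGs #266 (g)(ii) / #269 (d)(ii), porter val-port-1) from the page materialised by `lit read`
(`paper:arxiv-2212.11193`, p0003).  STATEMENT ONLY — NOT proved here; census: one typed-open fact.

## The source, verbatim (held `paper:arxiv-2212.11193`; bib key `GutermanMeshulamSpiridonov2023`)

A. E. Guterman, R. Meshulam, I. A. Spiridonov, *Maximal generalized rank in graphical matrix spaces*, Israel J. Math.
(2023), doi:10.1007/s11856-023-2508-6, arXiv:2212.11193.  p0003 L72–79 (definitions): «The `ω`-rank `rk_ω(A)` of a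
matrix `A ∈ M_n(𝔽)` is the maximal `k` such that there exist `I, J ∈ binom([n], k)` such that `D_ω(A[I|J]) ≠ 0`. …
Then `D_𝟙(A) = per A` is the permanent of `A`, and `prk(A) := rk_𝟙(A)` is the permanental rank of `A`.»
p0003 L94–97: «**Corollary 1.6.** Let `W ≤ M_n(𝔽)` be a linear subspace such that `prk(A) ≤ k` for all `A ∈ W`.
Then `dim W ≤ kn`.»  (Obtained, p0003 L81–92, by specialising their **Theorem 1.5** — the maximal dimension of a
graphical matrix space `W ≤ M_𝒷(𝔽)` of `ω`-rank `≤ k` equals `max {|𝒷'| : 𝒷' ⊆ 𝒷, ν_b(𝒷') ≤ k}` — to `𝒷 = [n]²`,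
`ω = 𝟙`, together with Kőnig–Egerváry `max {|𝒷'| : ν_b(𝒷') ≤ k} = kn` (p0003 L55–56); `𝔽` is an arbitrary field —
«over a field `𝔽`», p0003 L3.)

## What is typed

* `GutermanMeshulamSpiridonov2023_cor_1_6 F` — Corollary 1.6 over the field `F`, for square matrices indexed by
  `Fin n`, with the permanental rank written with the TREE's `Literature.Computability.AlgebraicComplexity.
  BoraleviCarliniMichalekVentura2025.prk` («the largest `h` such that some `h × h` submatrix has nonzero permanent»,
  BCMV 2025 Def. 1.1 after Yu 1999 — the same notion as the paper's `prk = rk_𝟙`: `D_𝟙(A[I|J])` is the permanent of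
  the submatrix on rows `I`, columns `J`, and the tree's `rsubperm` sums over bijections between the chosen index
  sets, which is that permanent up to the order-invariance of `per`).  Cited, not restated: `prk`, `rsubperm`.
Nothing is proved; the discharge route is the paper's (Theorem 1.5 via the Combinatorial Nullstellensatz — Mathlib's
`MvPolynomial.combinatorial_nullstellensatz_exists_eval_nonzero` — and Kőnig–Egerváry), size L.

TODO(general form): Theorem 1.5 itself (graphical spaces `M_𝒷(𝔽)`, general weights `ω`) and the equality cases
(p0003 L98 ff.) are not typed.  WHAT THIS IS NOT: no claim about `VP ≠ VNP` or about the `3/2` rung; the consumer's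
`GMSBound` (over `ℂ`, matrices as `Fin n × Fin n → ℂ`, "prk ≤ k" as «all `(k+1) × (k+1)` subpermanents along
injections vanish») follows from this fact by a bookkeeping bridge that is NOT in this file.
-/

namespace Literature.LinearAlgebra

open Module Matrix
open Literature.Computability.AlgebraicComplexity.BoraleviCarliniMichalekVentura2025 (prk)

/-- **Guterman–Meshulam–Spiridonov 2023, Corollary 1.6** (the permanental counterpart of Flanders–Meshulam): over
any field `F`, if `W` is a linear subspace of `M_n(F)` such that every `A ∈ W` has permanental rank `prk A ≤ k`
(no `(k+1) × (k+1)` submatrix of `A` has nonzero permanent), then `dim W ≤ k·n`.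
[cite: GutermanMeshulamSpiridonov2023, Cor. 1.6 (arXiv:2212.11193 p. 3, lit-read p0003 L94–97; via Thm. 1.5, p0003 L81–92)] -/
def GutermanMeshulamSpiridonov2023_cor_1_6 (F : Type*) [Field F] : Prop :=
  ∀ (n k : ℕ) (W : Submodule F (Matrix (Fin n) (Fin n) F)),
    (∀ A ∈ W, prk A ≤ k) → finrank F W ≤ k * n

end Literature.LinearAlgebra
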